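import Literature.Analysis.Complex.CauchyTransform
import Literature.Analysis.Complex.DbarAlongCalculus
import Mathlib.Analysis.Calculus.BumpFunction.InnerProduct
import Mathlib.Analysis.InnerProductSpace.Basic
import HarnessLib

/-!
# The `∂̄`-Poincaré lemma on polydiscs for `(0,1)`-forms (Hörmander, Theorem 2.3.3, `p = q = 0`)

Let `D = D(c, r) = {z ∈ ℂ^ι | |z_i - c_i| < r_i}` be an open polydisc (`ι` finite) and let
`f_j ∈ C^∞(D, F)`, `j ∈ ι`, be the coefficients of a smooth `∂̄`-closed `(0,1)`-form
`f = ∑ f_j dz̄_j`, i.e. `∂f_j/∂z̄_i = ∂f_i/∂z̄_j` on `D`. Then for every smaller polydisc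
`D' = D(c, r')`, `r' < r`, there is `u ∈ C^∞(ℂ^ι, F)` with `∂u/∂z̄_j = f_j` on `D'` for all `j`
(`Literature.Analysis.Complex.exists_dbarAlong_eq_on_polydisc`). Here `∂/∂z̄_j` is
`dbarAlong (Pi.single j 1)` (`Literature/Analysis/Complex/CauchyPompeiu.lean`).

This is Hörmander's Theorem 2.3.3 in the case `(p, q) = (0, 0)` (forms of type `(0,1)`), with
Hörmander's proof: induction on the set `s` of coordinates `k` for which `dz̄_k` occurs in `f`
(`f_j = 0` on `D` for `j ∉ s`). To remove `k ∈ s` one solves `∂G/∂z̄_k = f_k` near `D̄''`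
(`D' ⋐ D'' ⋐ D`) by the Cauchy transform in `z_k` of `χ f_k`, `χ` a product cut-off equal to `1`
near `D̄''` (`Literature/Analysis/Complex/CauchyTransform.lean`, Hörmander Thm. 1.2.2); since
`f_k` is holomorphic in `z_j`, `j ∉ s`, so is `G` on `D''` ((2.3.6)), and `f - ∂̄G` no longer
involves `dz̄_k`; it is again `∂̄`-closed because `∂²G/∂z̄_i∂z̄_j` is symmetric
(`Literature.Analysis.Complex.dbarAlong_comm`).

## Main results

* `Literature.Analysis.Complex.polydisc c r`: the open polydisc `Set.pi univ (ball (c i) (r i))`.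
* `Literature.Analysis.Complex.exists_polydisc_cutoff`: smooth product cut-offs `χ = ∏ ψ_i(z_i)`.
* `Literature.Analysis.Complex.exists_dbarAlong_eq_on_polydisc`: **Theorem 2.3.3 for
  `(0,1)`-forms**.
* `Literature.Analysis.Complex.exists_dbarAlong_eq_nhds`: local solvability of `∂̄u = f` for
  `∂̄`-closed `(0,1)`-data near any point of `ℂ^ι` (the `(0,1)` Dolbeault–Grothendieck lemma).

Not here: forms of type `(p, q+1)` with `p + q > 0` (this needs the exterior-algebra coefficient
calculus for the tree's `(p,q)`-forms) and the passage `D' ↑ D` (Hörmander, Thm. 2.7.8).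

## References

* L. Hörmander, *An Introduction to Complex Analysis in Several Variables*, 2nd ed. (1973),
  Thm. 2.3.3 and its proof, (2.3.4)–(2.3.6). [HormanderSCV1973]
-/

noncomputable section

open Set Filter Function Complex Metric
open scoped Topology ContDiff

namespace Literature.Analysis.Complex

variable {ι : Type*} [Fintype ι] [DecidableEq ι]
  {F : Type*} [NormedAddCommGroup F] [NormedSpace ℂ F]

/-! ### Polydiscs -/

omit [Fintype ι] [DecidableEq ι] in
/-- The **open polydisc** `D(c, r) = {z | ∀ i, |z_i - c_i| < r_i}` in `ℂ^ι` (Hörmander (1973),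
§2.2). For a constant radius it is the metric ball of the sup norm (`polydisc_const_eq_ball`).
[cite: HormanderSCV1973, §2.2] -/
def polydisc (c : ι → ℂ) (r : ι → ℝ) : Set (ι → ℂ) :=
  Set.pi univ fun i => ball (c i) (r i)

omit [Fintype ι] [DecidableEq ι] in
/-- Membership in a polydisc is coordinatewise. [folklore] -/
theorem mem_polydisc {c : ι → ℂ} {r : ι → ℝ} {z : ι → ℂ} :
    z ∈ polydisc c r ↔ ∀ i, z i ∈ ball (c i) (r i) := by
  simp [polydisc]

omit [DecidableEq ι] in
/-- Polydiscs are open. [folklore] -/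
theorem isOpen_polydisc (c : ι → ℂ) (r : ι → ℝ) : IsOpen (polydisc c r) :=
  isOpen_set_pi finite_univ fun _ _ => isOpen_ball

omit [Fintype ι] [DecidableEq ι] in
/-- Polydiscs are monotone in the radii. [folklore] -/
theorem polydisc_mono (c : ι → ℂ) {r r' : ι → ℝ} (h : ∀ i, r' i ≤ r i) :
    polydisc c r' ⊆ polydisc c r :=
  fun _ hz => mem_polydisc.2 fun i => ball_subset_ball (h i) (mem_polydisc.1 hz i)

omit [Fintype ι] [DecidableEq ι] in
/-- An open polydisc lies in the closed polydisc with the same radii. [folklore] -/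
theorem polydisc_subset_pi_closedBall (c : ι → ℂ) (r : ι → ℝ) :
    polydisc c r ⊆ Set.pi univ fun i => closedBall (c i) (r i) :=
  fun _ hz => fun i _ => ball_subset_closedBall (mem_polydisc.1 hz i)

omit [Fintype ι] [DecidableEq ι] in
/-- A closed polydisc lies in any open polydisc with larger radii. [folklore] -/
theorem pi_closedBall_subset_polydisc (c : ι → ℂ) {r r' : ι → ℝ} (h : ∀ i, r' i < r i) :
    (Set.pi univ fun i => closedBall (c i) (r' i)) ⊆ polydisc c r :=
  fun _ hz => mem_polydisc.2 fun i => closedBall_subset_ball (h i) (hz i (mem_univ i))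

omit [DecidableEq ι] in
/-- A polydisc with constant radius `R > 0` is the sup-norm ball. [folklore] -/
theorem polydisc_const_eq_ball [Nonempty ι] (c : ι → ℂ) {R : ℝ} (hR : 0 < R) :
    polydisc c (fun _ => R) = ball c R := by
  rw [polydisc, ball_pi c hR]

omit [Fintype ι] [DecidableEq ι] in
/-- A polydisc with a nonpositive radius is empty. [folklore] -/
theorem polydisc_eq_empty (c : ι → ℂ) {r : ι → ℝ} {i : ι} (hi : r i ≤ 0) : polydisc c r = ∅ := by
  ext z
  simp only [mem_polydisc, mem_empty_iff_false, iff_false, not_forall]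
  exact ⟨i, fun h => (mem_ball.1 h).not_ge (hi.trans dist_nonneg)⟩

/-! ### Product cut-offs -/

omit [DecidableEq ι] in
/-- **Smooth product cut-offs on `ℂ^ι`**: for radii `0 < a_i < b_i` there is `χ ∈ C^∞(ℂ^ι)`,
`χ = ∏ ψ_i(z_i)` with one-variable bumps `ψ_i` (Mathlib's `ContDiffBump`), equal to `1` on the
closed polydisc of radii `a`, supported in the closed polydisc of radii `b`, and locally
independent of `z_j` at points with `|z_j - c_j| < a_j` (so that `∂χ/∂z̄_j = 0` there). These are
the cut-offs "`ψ(z_k) = 1` in a neighborhood of `D̄'`" of Hörmander's proof of Thm. 2.3.3, taken in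
all variables at once. [folklore] -/
theorem exists_polydisc_cutoff [DecidableEq ι] (c : ι → ℂ) {a b : ι → ℝ} (ha : ∀ i, 0 < a i)
    (hab : ∀ i, a i < b i) :
    ∃ χ : (ι → ℂ) → ℂ, ContDiff ℝ ∞ χ ∧ HasCompactSupport χ ∧
      tsupport χ ⊆ Set.pi univ (fun i => closedBall (c i) (b i)) ∧
      (∀ z ∈ Set.pi univ (fun i => closedBall (c i) (a i)), χ z = 1) ∧
      ∀ (j : ι) (y : ι → ℂ), y j ∈ ball (c j) (a j) →
        ∀ᶠ τ : ℂ in 𝓝 0, χ (y + τ • Pi.single j 1) = χ y := by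
  let ψ : ∀ i : ι, ContDiffBump (c i) := fun i => ⟨a i, b i, ha i, hab i⟩
  refine ⟨fun z => ∏ i, ((ψ i) (z i) : ℂ), ?_, ?_, ?_, ?_, ?_⟩
  · exact contDiff_prod fun i _ => ofRealCLM.contDiff.comp
      ((ψ i).contDiff.comp (contDiff_apply ℝ ℂ i))
  · refine HasCompactSupport.of_support_subset_isCompact
      (isCompact_univ_pi fun i => isCompact_closedBall (c i) (b i)) fun z hz i _ => ?_
    have h : (ψ i) (z i) ≠ 0 := fun h0 => hz (Finset.prod_eq_zero (Finset.mem_univ i) (by simp [h0]))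
    have : z i ∈ Function.support (ψ i) := h
    rw [(ψ i).support_eq] at this
    exact ball_subset_closedBall this
  · refine closure_minimal (fun z hz i _ => ?_) (isClosed_set_pi fun i _ => isClosed_closedBall)
    have h : (ψ i) (z i) ≠ 0 := fun h0 => hz (Finset.prod_eq_zero (Finset.mem_univ i) (by simp [h0]))
    have : z i ∈ Function.support (ψ i) := h
    rw [(ψ i).support_eq] at this
    exact ball_subset_closedBall this
  · intro z hz
    exact Finset.prod_eq_one fun i _ => by
      rw [(ψ i).one_of_mem_closedBall (hz i (mem_univ i)), ofReal_one]
  · intro j y hy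
    have hτ : ∀ᶠ τ : ℂ in 𝓝 0, y j + τ ∈ ball (c j) (a j) := by
      have hc : Continuous fun τ : ℂ => y j + τ := continuous_const.add continuous_id
      exact hc.continuousAt.preimage_mem_nhds (by simpa using isOpen_ball.mem_nhds hy)
    filter_upwards [hτ] with τ hτ'
    refine Finset.prod_congr rfl fun i _ => ?_
    by_cases hij : i = j
    · subst hij
      have h1 : (ψ i) (y i + τ) = 1 := (ψ i).one_of_mem_closedBall (ball_subset_closedBall hτ')
      have h2 : (ψ i) (y i) = 1 := (ψ i).one_of_mem_closedBall (ball_subset_closedBall hy)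
      simp [h1, h2]
    · simp [hij]

/-! ### The induction step data -/

section Step

variable [CompleteSpace F]

omit [Fintype ι] in
/-- The coordinate vector `e_k = Pi.single k 1` is nonzero. [folklore] -/
theorem single_one_ne_zero (k : ι) : (Pi.single k (1 : ℂ) : ι → ℂ) ≠ 0 := by
  intro h
  have := congr_fun h k
  simp at this

/-- **Hörmander's Theorem 2.3.3 for `(0,1)`-forms, inductive form.** For a finite set `s` of
coordinates: if `f_j ∈ C^∞(D(c,r))` satisfy `∂f_j/∂z̄_i = ∂f_i/∂z̄_j` on `D(c, r)` and `f_j = 0`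
on `D(c, r)` for `j ∉ s` ("`f` does not involve `dz̄_j`, `j ∉ s`"), then for `0 < r' < r` there is
`u ∈ C^∞(ℂ^ι)` with `∂u/∂z̄_j = f_j` on `D(c, r')` for all `j`. Proof by induction on `s`,
following Hörmander. [cite: HormanderSCV1973, Thm. 2.3.3] -/
theorem exists_dbarAlong_eq_on_polydisc_of_vanishing (s : Finset ι) :
    ∀ (c : ι → ℂ) (r r' : ι → ℝ), (∀ i, 0 < r' i) → (∀ i, r' i < r i) →
    ∀ f : ι → (ι → ℂ) → F, (∀ j, ContDiffOn ℝ ∞ (f j) (polydisc c r)) →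
    (∀ i j, ∀ z ∈ polydisc c r,
      dbarAlong (Pi.single i 1) (f j) z = dbarAlong (Pi.single j 1) (f i) z) →
    (∀ j, j ∉ s → ∀ z ∈ polydisc c r, f j z = 0) →
    ∃ u : (ι → ℂ) → F, ContDiff ℝ ∞ u ∧
      ∀ j, ∀ z ∈ polydisc c r', dbarAlong (Pi.single j 1) u z = f j z := by
  induction s using Finset.induction_on with
  | empty =>
    intro c r r' _ hr f _ _ hvan
    refine ⟨0, contDiff_const, fun j z hz => ?_⟩
    rw [dbarAlong_zero, hvan j (by simp) z (polydisc_mono c (fun i => (hr i).le) hz)]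
  | insert k s hk ih =>
    intro c r r' hr'0 hr'r f hf hcl hvan
    -- intermediate radii `r' < r'' < b < r`
    set r'' : ι → ℝ := fun i => (r' i + r i) / 2 with hr''_def
    set b : ι → ℝ := fun i => (r'' i + r i) / 2 with hb_def
    have h1 : ∀ i, r' i < r'' i := fun i => by simp only [hr''_def]; linarith [hr'r i]
    have h2 : ∀ i, r'' i < r i := fun i => by simp only [hr''_def]; linarith [hr'r i]
    have h3 : ∀ i, r'' i < b i := fun i => by simp only [hb_def]; linarith [h2 i]
    have h4 : ∀ i, b i < r i := fun i => by simp only [hb_def]; linarith [h2 i]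
    have h0 : ∀ i, 0 < r'' i := fun i => (hr'0 i).trans (h1 i)
    have hD''D : polydisc c r'' ⊆ polydisc c r := polydisc_mono c fun i => (h2 i).le
    have hDo : IsOpen (polydisc c r) := isOpen_polydisc c r
    -- the cut-off and the corrected coefficient `g = χ f_k ∈ C_c^∞`
    obtain ⟨χ, hχ, hχc, hχt, hχ1, hχi⟩ := exists_polydisc_cutoff c h0 h3
    have hχD : tsupport χ ⊆ polydisc c r := hχt.trans (pi_closedBall_subset_polydisc c h4)
    set g : (ι → ℂ) → F := fun z => χ z • f k z with hg_def
    have hg : ContDiff ℝ ∞ g := contDiff_smul_of_tsupport_subset hDo hχ hχD (hf k)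
    have hg1 : ContDiff ℝ 1 g := hg.of_le (by exact_mod_cast le_top)
    have hgc : HasCompactSupport g := hχc.smul_right
    have hek := single_one_ne_zero (ι := ι) k
    -- `G = T_{e_k} g`: `∂G/∂z̄_k = g`, and `∂G/∂z̄_j = 0` on `D''` for `j ∉ insert k s`
    set G : (ι → ℂ) → F := cauchyTransformAlong (Pi.single k 1) g with hG_def
    have hG : ContDiff ℝ ∞ G := contDiff_cauchyTransformAlong hg hgc hek
    have hGd : ∀ z, DifferentiableAt ℝ G z := fun z =>
      hG.contDiffAt.differentiableAt (by simp)
    have hGk : ∀ z ∈ polydisc c r'', dbarAlong (Pi.single k 1) G z = f k z := fun z hz => by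
      rw [hG_def, dbarAlong_cauchyTransformAlong hg1 hgc hek, hg_def]
      simp only
      rw [hχ1 z (polydisc_subset_pi_closedBall c r'' hz), one_smul]
    have hGj : ∀ j, j ∉ insert k s → ∀ z ∈ polydisc c r'',
        dbarAlong (Pi.single j 1) G z = 0 := fun j hj z hz => by
      have hjk : j ≠ k := fun h => hj (h ▸ Finset.mem_insert_self k s)
      refine dbarAlong_cauchyTransformAlong_eq_zero hg1 hgc hek fun t => ?_
      set y := z - t • (Pi.single k (1 : ℂ) : ι → ℂ) with hy_def
      by_cases hy : y ∈ polydisc c r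
      · have hfd : DifferentiableAt ℝ (f k) y :=
          ((hf k).contDiffAt (hDo.mem_nhds hy)).differentiableAt (by simp)
        rw [hg_def, dbarAlong_smul ((hχ.differentiable (by simp)) y) hfd]
        have hχ0 : dbarAlong (Pi.single j 1) χ y = 0 := by
          refine dbarAlong_eq_zero_of_eventually_eq (hχi j y ?_)
          have : y j = z j := by simp [hy_def, hjk]
          rw [this]
          exact mem_polydisc.1 hz j
        have hf0 : dbarAlong (Pi.single j 1) (f k) y = 0 := by
          rw [hcl j k y hy]
          refine dbarAlong_eq_zero_of_eventuallyEq_zero ?_ _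
          filter_upwards [hDo.mem_nhds hy] with w hw
          exact hvan j hj w hw
        rw [hχ0, hf0, zero_smul, smul_zero, add_zero]
      · have h0 : g =ᶠ[𝓝 y] 0 := by
          filter_upwards [notMem_tsupport_iff_eventuallyEq.1 fun h => hy (hχD h)] with w hw
          simp [hg_def, hw]
        exact dbarAlong_eq_zero_of_eventuallyEq_zero h0 _
    -- the new data `f' = f - ∂̄G` on `D''`: smooth, `∂̄`-closed, not involving `dz̄_j`, `j ∉ s`
    set f' : ι → (ι → ℂ) → F := fun j z => f j z - dbarAlong (Pi.single j 1) G z with hf'_def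
    have hGs : ∀ j, ContDiff ℝ ∞ (dbarAlong (Pi.single j 1) G) := fun j =>
      contDiff_infty_dbarAlong hG _
    have hf' : ∀ j, ContDiffOn ℝ ∞ (f' j) (polydisc c r'') := fun j =>
      ((hf j).mono hD''D).sub (hGs j).contDiffOn
    have hfd : ∀ j, ∀ z ∈ polydisc c r, DifferentiableAt ℝ (f j) z := fun j z hz =>
      ((hf j).contDiffAt (hDo.mem_nhds hz)).differentiableAt (by simp)
    have hGsd : ∀ j z, DifferentiableAt ℝ (dbarAlong (Pi.single j 1) G) z := fun j z =>
      (hGs j).contDiffAt.differentiableAt (by simp)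
    have hcl' : ∀ i j, ∀ z ∈ polydisc c r'',
        dbarAlong (Pi.single i 1) (f' j) z = dbarAlong (Pi.single j 1) (f' i) z := by
      intro i j z hz
      have hzD := hD''D hz
      simp only [hf'_def]
      rw [dbarAlong_sub (hfd j z hzD) (hGsd j z), dbarAlong_sub (hfd i z hzD) (hGsd i z),
        hcl i j z hzD, dbarAlong_comm hG.contDiffAt (by norm_cast) (Pi.single i 1) (Pi.single j 1)]
    have hvan' : ∀ j, j ∉ s → ∀ z ∈ polydisc c r'', f' j z = 0 := by
      intro j hj z hz
      simp only [hf'_def]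
      by_cases hjk : j = k
      · rw [hjk, hGk z hz, sub_self]
      · have hj' : j ∉ insert k s := by simp [hjk, hj]
        rw [hvan j hj' z (hD''D hz), hGj j hj' z hz, sub_zero]
    -- induction hypothesis on `D' ⋐ D''`, and `u = v + G`
    obtain ⟨v, hv, hvf⟩ := ih c r'' r' hr'0 h1 f' hf' hcl' hvan'
    refine ⟨fun z => v z + G z, hv.add hG, fun j z hz => ?_⟩
    rw [dbarAlong_fun_add (hv.contDiffAt.differentiableAt (by simp)) (hGd z), hvf j z hz]
    simp only [hf'_def]
    abel

/-- **The `∂̄`-Poincaré lemma on polydiscs for `(0,1)`-forms** (Hörmander (1973), Thm. 2.3.3 with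
`(p, q) = (0, 0)`; Dolbeault–Grothendieck lemma): let `D = D(c, r) ⊆ ℂ^ι` be an open polydisc and
`f_j ∈ C^∞(D, F)` (`j ∈ ι`) with `∂f_j/∂z̄_i = ∂f_i/∂z̄_j` on `D` (i.e. `∂̄ (∑ f_j dz̄_j) = 0`).
Then for all radii `r' < r` there is `u ∈ C^∞(ℂ^ι, F)` with `∂u/∂z̄_j = f_j` on `D(c, r')` for
every `j` (i.e. `∂̄ u = f` on `D' ⋐ D`). [cite: HormanderSCV1973, Thm. 2.3.3] -/
theorem exists_dbarAlong_eq_on_polydisc {c : ι → ℂ} {r r' : ι → ℝ} (hr : ∀ i, r' i < r i)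
    {f : ι → (ι → ℂ) → F} (hf : ∀ j, ContDiffOn ℝ ∞ (f j) (polydisc c r))
    (hcl : ∀ i j, ∀ z ∈ polydisc c r,
      dbarAlong (Pi.single i 1) (f j) z = dbarAlong (Pi.single j 1) (f i) z) :
    ∃ u : (ι → ℂ) → F, ContDiff ℝ ∞ u ∧
      ∀ j, ∀ z ∈ polydisc c r', dbarAlong (Pi.single j 1) u z = f j z := by
  by_cases h0 : ∀ i, 0 < r' i
  · exact exists_dbarAlong_eq_on_polydisc_of_vanishing Finset.univ c r r' h0 hr f hf hcl
      fun j hj => absurd (Finset.mem_univ j) hj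
  · obtain ⟨i, hi⟩ := not_forall.mp h0
    refine ⟨0, contDiff_const, fun j z hz => ?_⟩
    rw [polydisc_eq_empty c (not_lt.mp hi)] at hz
    exact absurd hz (notMem_empty z)

/-- **Local solvability of `∂̄u = f` for `(0,1)`-forms** (the Dolbeault–Grothendieck lemma in
degree `(0,1)`, Hörmander (1973), Thm. 2.3.3): if `f_j` are smooth near `x ∈ ℂ^ι` with
`∂f_j/∂z̄_i = ∂f_i/∂z̄_j`, then on some neighborhood `V` of `x` there is a smooth `u` with
`∂u/∂z̄_j = f_j` on `V` for all `j`. [cite: HormanderSCV1973, Thm. 2.3.3] -/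
theorem exists_dbarAlong_eq_nhds {x : ι → ℂ} {U : Set (ι → ℂ)} (hU : U ∈ 𝓝 x)
    {f : ι → (ι → ℂ) → F} (hf : ∀ j, ContDiffOn ℝ ∞ (f j) U)
    (hcl : ∀ i j, ∀ z ∈ U, dbarAlong (Pi.single i 1) (f j) z = dbarAlong (Pi.single j 1) (f i) z) :
    ∃ V ∈ 𝓝 x, ∃ u : (ι → ℂ) → F, ContDiff ℝ ∞ u ∧
      ∀ j, ∀ z ∈ V, dbarAlong (Pi.single j 1) u z = f j z := by
  obtain ⟨ε, hε, hball⟩ := Metric.mem_nhds_iff.1 hU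
  have hsub : polydisc x (fun _ => ε) ⊆ U := fun z hz =>
    hball (mem_ball.2 ((dist_pi_lt_iff hε).2 fun i => mem_ball.1 (mem_polydisc.1 hz i)))
  obtain ⟨u, hu, huf⟩ := exists_dbarAlong_eq_on_polydisc (c := x) (r := fun _ => ε)
    (r' := fun _ => ε / 2) (fun _ => by linarith) (fun j => (hf j).mono hsub)
    fun i j z hz => hcl i j z (hsub hz)
  exact ⟨polydisc x fun _ => ε / 2, (isOpen_polydisc _ _).mem_nhds
    (mem_polydisc.2 fun i => mem_ball_self (by linarith)), u, hu, huf⟩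

end Step

end Literature.Analysis.Complex
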